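import Mathlib.Combinatorics.SimpleGraph.LapMatrix
import Literature.MathematicalPhysics.QuantumFieldTheory.Balaban1983to89.B2Eq234SecondRepr
import Literature.MathematicalPhysics.QuantumFieldTheory.Balaban1983to89.B2Eq218Translation

/-!
# `Balaban1983to89.B2Eq234Lattice` — [Balaban1982Higgs2] (2.34) p. 564, part 3 of 3: the VECTOR-FIELD line of the second
representation with every hypothesis discharged — `Q* = B2Eq218Translation.qstar` (r02's block-averaging kernel), `−Δ` the
Laplacian of a (nearest-neighbour) simple graph on the field components (Mathlib `SimpleGraph.lapMatrix`), mass `μ₀²ε² > 0`,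
`st(Λ₅)` = the graph's bonds from `Λ₅` to `Λ₅ᶜ`, couplings `u ≡ 1` — and the Dirichlet reading of `−Δ^D_{Λ₅ᶜ}` (part I (2.32))
as the sum over bonds of the squared differences of the field EXTENDED BY ZERO on `Λ₅`

statement-level skeleton of published theorems with citation tags; proofs where landed; nothing here is a claim about the Yang–Mills mass gap

PDF held: `paper:balaban1982-cmp86-higgs23-ii` (T. Bałaban, *(Higgs)₂,₃ quantum fields in a finite volume. II. An upper
bound*, Commun. Math. Phys. **86** (1982) 555–594, doi 10.1007/bf01214890; journal page = PDF page + 554); pp. 563–565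
[PDF 9–11] READ AS IMAGES on the ×2 renders
`run/shared/lean/pub/pub-balaban/b2b-balaban-ref1/pages/1982-cmp86-higgs23-II/1982-cmp86-higgs23-II-p009-x2.png` … `-p011-x2.png`;
part I [Balaban1982Higgs1] (2.32) p. 611 [PDF 9] on `…/1982-cmp85-higgs23-I/1982-cmp85-higgs23-I-p009-x2.png`.

CITATION HEADER — WHAT IS REPRODUCED.  SKELETON row **B2.Eq2.42** ((2.20)–(2.42)), member **(2.34)** p. 564 — the line
*"−½aL^{d−2}Σ_{y∈Λ₅ᶜ}|B(y) − (QA)(y)|² − ½⟨A, (−Δ^D_{Λ₅ᶜ} + μ₀²ε²)A⟩ + ½Σ_{b,b′∈st(Λ₅)} A(b₊)·C^{(0)}_{Λ₅}(b₋, b′₋)A(b′₊)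
+ aL⁻²Σ_{b∈st(Λ₅)} A(b₊)·(C^{(0)}_{Λ₅}Q*B)(b₋) − ½⟨B, Δ^{(1),L}_{Λ₅}B⟩"* and the factor *"∫dA↾_{Λ₅} exp(−½⟨A, (C^{(0)}_{Λ₅})⁻¹A⟩)"*;
the model dictionary, the exponents `firstExp`/`secondExp` and the general identity `secondRepr` are in parts 1–2
(`…B2Eq234Exponent`, `…B2Eq234SecondRepr`, same unit).  Unit `lit-balaban-p15` gen 3 (Phase-2 proof seat p15; HOME
`run/shared/lean/pub/lit-balaban/`, seat dir `lit-balaban-p15/`); B2 fold owner r02, second reader r14; referee ref-4.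

WHAT IS KERNEL-CHECKED (zero `sorry`, standard axioms).  §1 `qstar_blockSupport` (*"Λ is a union of big blocks"*, I (2.32),
for r02's `qstar w blk`: `x ∈ Λ₅ ⇔ y(x) ∈ Λ′₅`), `latticeD` (`−Δ + μ·1`), `latticeSt` (`st(Λ₅)`: bonds `b₋ ∈ Λ₅`, `b₊ ∈ Λ₅ᶜ`;
p. 563 *"∂Λ₅ = {x ∈ Λ₅ᶜ : x = b₊ for some b ∈ st(Λ₅)}"*), `lattice_hst` (no other `Λ₅Λ₅ᶜ` coupling), `lattice_coupling`
(`u_b = 1`: the case (2.29)), `posDef_mainOp_lattice` (`(−Δ + μ) + κQ*Q > 0` for `μ > 0`, `κ ≥ 0`), **`secondRepr_vector`**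
= (2.34) for the vector field with the printed boundary terms and NO hypothesis left besides `μ > 0`, `κ ≥ 0`, `Λ₅` a union
of blocks, `G` bounded measurable; §2 `lapMatrix_dirichlet`: `⟨A, (−Δ^D_{Λ₅ᶜ} + μ)A⟩ = ½ΣΣ_{i∼j}(Ã_i − Ã_j)² + μΣ_iÃ_i²`,
`Ã = A↾_{Λ₅ᶜ}` extended by `0` (part I (2.32): `A↾_Λ = ΛAΛ`).
HONEST SCOPE.  `S` = sites × vector components of the unit lattice `T₁` (the print's `−Δ` acts componentwise; any simple
graph is allowed here, the nearest-neighbour torus graph being the printed case); `κ` ↤ `aL^{d−2}`, `w` ↤ `L^{−d}`,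
`μ` ↤ `μ₀²ε²`; the scalar-field line of (2.34) is the same identity with `U(B̃^{(1)}_b)`-entries as couplings
(`…B2Eq234SecondRepr.secondRepr`, `display230`) and is not given a separate lattice instance here.
-/

open MeasureTheory Matrix Finset
open scoped BigOperators

namespace Literature.MathematicalPhysics.QuantumFieldTheory.Balaban1983to89.B2Eq234Lattice

open B2Eq228Conditioning B2Eq234Exponent B2Eq234SecondRepr

variable {S : Type} [Fintype S] (p : S → Prop) [DecidablePred p] [DecidableEq S]
  {T : Type} [Fintype T] (pT : T → Prop) [DecidablePred pT]

/-! ## §1 The vector field of (2.34) literally: `Q* = qstar`, `−Δ` a nearest-neighbour graph Laplacian, `u ≡ 1` -/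

section Vector

variable {Y : Type} [Fintype Y] [DecidableEq Y] (pY : Y → Prop) [DecidablePred pY]

omit [Fintype S] [DecidablePred p] [DecidableEq S] [Fintype Y] [DecidablePred pY] in
/-- r02's averaging kernel `qstar w blk` respects a union of blocks: `x ∈ Λ₅ ⇔ y(x) ∈ Λ′₅` gives the support
hypothesis `hQ`. [cite: Balaban1982Higgs1, (2.32) p.611] -/
theorem qstar_blockSupport (w : ℝ) (blk : S → Y) (hblk : ∀ x, p x ↔ pY (blk x)) :
    ∀ s t, B2Eq218Translation.qstar w blk s t ≠ 0 → (p s ↔ pY t) := by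
  intro s t h
  have hst : blk s = t := by
    by_contra hne
    exact h (by simp [B2Eq218Translation.qstar, hne])
  rw [← hst]
  exact hblk s

/-- `−Δ + μ₀²ε²` ↦ `L + μ·1` with `L` the Laplacian of a simple graph on the field components (the nearest-neighbour
graph of `T₁`, componentwise): the vector-field operator `D` of (2.34). [cite: Balaban1982Higgs2, (2.34) p.564] -/
noncomputable def latticeD (G : SimpleGraph S) [DecidableRel G.Adj] (μ : ℝ) : Matrix S S ℝ :=
  G.lapMatrix ℝ + μ • (1 : Matrix S S ℝ)

/-- `st(Λ₅)` ↦ the graph's bonds from `Λ₅` to `Λ₅ᶜ`, oriented `b₋ ∈ Λ₅`, `b₊ ∈ Λ₅ᶜ` (p. 563: *"∂Λ₅ = {x ∈ Λ₅ᶜ : x = b₊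
for some b ∈ st(Λ₅)}"*). [cite: Balaban1982Higgs2, (2.29) p.563] -/
def latticeSt (G : SimpleGraph S) [DecidableRel G.Adj] : Finset (In p × Out p) :=
  univ.filter (fun b => G.Adj b.1.1 b.2.1)

/-- Off the bonds `st(Λ₅)` the operator `−Δ + μ₀²ε²` does not couple `Λ₅` to `Λ₅ᶜ`. [cite: Balaban1982Higgs2, (2.29) p.563] -/
theorem lattice_hst (G : SimpleGraph S) [DecidableRel G.Adj] (μ : ℝ) :
    ∀ i j, (i, j) ∉ latticeSt p G → blkMix p (latticeD G μ) i j = 0 := by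
  intro i j hij
  have hadj : ¬ G.Adj i.1 j.1 := by
    intro h
    exact hij (Finset.mem_filter.2 ⟨Finset.mem_univ _, h⟩)
  have hne : (i.1 : S) ≠ j.1 := fun h => j.2 (h ▸ i.2)
  simp [blkMix, latticeD, SimpleGraph.lapMatrix, SimpleGraph.degMatrix, SimpleGraph.adjMatrix_apply,
    Matrix.diagonal_apply_ne _ hne, Matrix.one_apply_ne hne, hadj]

/-- Across a bond of `st(Λ₅)` the coupling of `−Δ + μ₀²ε²` is `−1`, i.e. `u_b = 1` (the case (2.29) of the shift).
[cite: Balaban1982Higgs2, (2.29) p.563] -/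
theorem lattice_coupling (G : SimpleGraph S) [DecidableRel G.Adj] (μ : ℝ) :
    ∀ b ∈ latticeSt p G, -blkMix p (latticeD G μ) b.1 b.2 = 1 := by
  intro b hb
  have hadj : G.Adj b.1.1 b.2.1 := (Finset.mem_filter.1 hb).2
  have hne : (b.1.1 : S) ≠ b.2.1 := fun h => b.2.2 (h ▸ b.1.2)
  simp [blkMix, latticeD, SimpleGraph.lapMatrix, SimpleGraph.degMatrix, SimpleGraph.adjMatrix_apply,
    Matrix.diagonal_apply_ne _ hne, Matrix.one_apply_ne hne, hadj]

omit [DecidablePred p] in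
/-- The main operator `(−Δ + μ·1) + κQ*Q` is positive definite for `μ > 0`, `κ ≥ 0` (graph Laplacian ≥ 0, Mathlib
`SimpleGraph.posSemidef_lapMatrix`; `Q*Q ≥ 0`). [cite: Balaban1982Higgs2, (2.34) p.564] -/
theorem posDef_mainOp_lattice (G : SimpleGraph S) [DecidableRel G.Adj] {μ κ : ℝ} (hμ : 0 < μ) (hκ : 0 ≤ κ)
    (Qm : Matrix S T ℝ) : (mainOp κ Qm (latticeD G μ)).PosDef := by
  have hL : (G.lapMatrix ℝ).PosSemidef := SimpleGraph.posSemidef_lapMatrix ℝ G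
  have h1 : (μ • (1 : Matrix S S ℝ)).PosDef := Matrix.PosDef.one.smul hμ
  have hD : (latticeD G μ).PosDef := Matrix.PosDef.posSemidef_add hL h1
  have hQQ : (κ • (Qm * Qmᵀ)).PosSemidef := by
    have h := Matrix.posSemidef_self_mul_conjTranspose Qm
    rw [conjTranspose_eq_transpose_of_trivial] at h
    exact h.smul hκ
  exact hD.add_posSemidef hQQ

/-- **(2.34) for the vector field, all hypotheses discharged**: on a finite unit lattice `S` with nearest-neighbour graph
`G` (`−Δ` = its Laplacian), mass term `μ = μ₀²ε² > 0`, blocks `blk : S → Y` with `Λ₅` a union of blocks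
(`hblk : x ∈ Λ₅ ⇔ y(x) ∈ Λ′₅`), `κ = aL^{d−2} ≥ 0`, `Q* = qstar w blk`, and a bounded measurable weight `G(A↾_{Λ₅ᶜ})`:
`∫dA G exp[−½κΣ_y|B(y) − (QA)(y)|² − ½⟨A,(−Δ+μ)A⟩]
 = ∫dA↾_{Λ₅ᶜ} G exp[−½κΣ_{y∉Λ′₅}|B(y) − (QA)(y)|² − ½⟨A,(−Δ^D_{Λ₅ᶜ}+μ)A⟩ + ½Σ_{b,b′∈st(Λ₅)}A(b₊)C^{(0)}_{Λ₅}(b₋,b′₋)A(b′₊)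
   + Σ_{b∈st(Λ₅)}A(b₊)(C^{(0)}_{Λ₅}(κQ*B))(b₋) − ½⟨B,Δ^{(1),L}_{Λ₅}B⟩] · ∫dA↾_{Λ₅}exp(−½⟨A,(C^{(0)}_{Λ₅})⁻¹A⟩)`.
[cite: Balaban1982Higgs2, (2.34) p.564] -/
theorem secondRepr_vector (G : SimpleGraph S) [DecidableRel G.Adj] {μ κ : ℝ} (hμ : 0 < μ) (hκ : 0 ≤ κ)
    (w : ℝ) (blk : S → Y) (hblk : ∀ x, p x ↔ pY (blk x)) {G₀ : (Out p → ℝ) → ℝ} (hG : Measurable G₀)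
    {CG : ℝ} (hGb : ∀ y, |G₀ y| ≤ CG) (B : Y → ℝ) :
    ∫ A, G₀ (resOut p A) * Real.exp (firstExp κ (B2Eq218Translation.qstar w blk) (latticeD G μ) B A)
      = (∫ y, G₀ y * Real.exp (
            -(1 / 2 : ℝ) * κ * ∑ t ∈ univ.filter (fun t => ¬ pY t),
                (B t - ((B2Eq218Translation.qstar w blk)ᵀ *ᵥ glue p 0 y) t) ^ 2
            - (1 / 2 : ℝ) * (y ⬝ᵥ (blkOut p (latticeD G μ) *ᵥ y))
            + (1 / 2 : ℝ) * ∑ b ∈ latticeSt p G, ∑ b' ∈ latticeSt p G,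
                y b.2 * cov p (mainOp κ (B2Eq218Translation.qstar w blk) (latticeD G μ)) b.1 b'.1 * y b'.2
            + ∑ b ∈ latticeSt p G, y b.2 *
                (cov p (mainOp κ (B2Eq218Translation.qstar w blk) (latticeD G μ))
                  *ᵥ resIn p (κ • (B2Eq218Translation.qstar w blk *ᵥ B))) b.1
            - (1 / 2 : ℝ) * form227 p pY κ (B2Eq218Translation.qstar w blk) (latticeD G μ) B))
          * ∫ x, Real.exp (-(1 / 2 : ℝ) *
              (x ⬝ᵥ (blkIn p (mainOp κ (B2Eq218Translation.qstar w blk) (latticeD G μ)) *ᵥ x))) := by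
  have h := secondRepr p pY κ (B2Eq218Translation.qstar w blk) (latticeD G μ) (posDef_mainOp_lattice G hμ hκ _)
    (qstar_blockSupport p pY w blk hblk) (latticeSt p G) (lattice_hst p G μ) hG hGb B
  rw [h]
  congr 1
  refine integral_congr_ae (Filter.Eventually.of_forall fun y => ?_)
  show G₀ y * Real.exp (secondExp p pY κ (B2Eq218Translation.qstar w blk) (latticeD G μ) (latticeSt p G) B y) = _
  congr 2
  have hquad : bdryQuad p (cov p (mainOp κ (B2Eq218Translation.qstar w blk) (latticeD G μ))) (latticeSt p G)
        (fun b => -blkMix p (latticeD G μ) b.1 b.2) y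
      = (1 / 2 : ℝ) * ∑ b ∈ latticeSt p G, ∑ b' ∈ latticeSt p G,
          y b.2 * cov p (mainOp κ (B2Eq218Translation.qstar w blk) (latticeD G μ)) b.1 b'.1 * y b'.2 := by
    unfold bdryQuad
    congr 1
    refine Finset.sum_congr rfl fun b hb => Finset.sum_congr rfl fun b' hb' => ?_
    beta_reduce
    rw [lattice_coupling p G μ b hb, lattice_coupling p G μ b' hb']
    ring
  have hlin : bdryLin p (cov p (mainOp κ (B2Eq218Translation.qstar w blk) (latticeD G μ))) (latticeSt p G)
        (fun b => -blkMix p (latticeD G μ) b.1 b.2) (resIn p (κ • (B2Eq218Translation.qstar w blk *ᵥ B))) y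
      = ∑ b ∈ latticeSt p G, y b.2 * (cov p (mainOp κ (B2Eq218Translation.qstar w blk) (latticeD G μ))
          *ᵥ resIn p (κ • (B2Eq218Translation.qstar w blk *ᵥ B))) b.1 := by
    unfold bdryLin
    refine Finset.sum_congr rfl fun b hb => ?_
    beta_reduce
    rw [lattice_coupling p G μ b hb, mul_one]
  rw [secondExp, hquad, hlin]

end Vector


/-! ## §2 The Dirichlet Laplacian of (2.34) as a sum over bonds (field set to `0` on `Λ₅`) -/

/-- For `D = −Δ + μ·1` with `−Δ` a graph Laplacian: `⟨A, (−Δ^D_{Λ₅ᶜ} + μ)A⟩ = ⟨y, D↾_{Λ₅ᶜ}y⟩ =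
½ΣΣ_{i∼j}(ỹ_i − ỹ_j)² + μΣ_iỹ_i²`, `ỹ = y` extended by `0` on `Λ₅` — the bonds inside `Λ₅ᶜ` and, ONCE each (the two
orientations halve), the squares `y(b₊)²` over `st(Λ₅)`: the Dirichlet boundary condition of part I (2.32).
[cite: Balaban1982Higgs1, (2.32) p.611] -/
theorem lapMatrix_dirichlet (G : SimpleGraph S) [DecidableRel G.Adj] (μ : ℝ) (y : Out p → ℝ) :
    y ⬝ᵥ (blkOut p (latticeD G μ) *ᵥ y)
      = (∑ i, ∑ j, if G.Adj i j then (glue p 0 y i - glue p 0 y j) ^ 2 else 0) / 2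
          + μ * ∑ i, glue p 0 y i ^ 2 := by
  rw [quadForm_blkOut, latticeD, add_mulVec, dotProduct_add, ← Matrix.toLinearMap₂'_apply',
    SimpleGraph.lapMatrix_toLinearMap₂', smul_mulVec, one_mulVec, dotProduct_smul, smul_eq_mul, dotProduct]
  congr 1
  congr 1
  exact Finset.sum_congr rfl fun i _ => by ring


end Literature.MathematicalPhysics.QuantumFieldTheory.Balaban1983to89.B2Eq234Lattice
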